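import Literature.Probability.Percolation.AltFourArm
import Literature.Probability.Percolation.ArmSeparationFourArmProofs
import Literature.Probability.Percolation.NearCriticalFourArmFacts
import HarnessLib

/-!
# Colour patterns of the order-free four-arm event: the bridge between `π₄` and the alternating event

Topic `Literature/Probability/Percolation`; family `crit-perc`. Serves the named fact
`Literature.Probability.Percolation.fourArm_exponent` (`ArmExponents.lean`; S. Smirnov, W. Werner,
*Critical exponents for two-dimensional percolation*, Math. Res. Lett. **8** (2001), Thm. 4 for
`j = 4`: `b₄(r, R) = R^{-5/4 + o(1)}`), whose Lean statement is about the tree's ORDER-FREE event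
`armEvent ![T,F,T,F] r R` — two open and two closed pairwise disjoint crossings of `Λ_R ∖ Λ_r`, the
cyclic order of the colours around the annulus NOT being imposed (`ArmEvents.lean`, design note) —
exactly as Smirnov–Werner's `H_j(r, R)` ("`j` disjoint crossings of the annulus, not all of the same
colour … One can also prescribe colours of the crossings and their order, which will change `b_j` up
to a multiplicative constant (we will justify this rigorously later)", §4, p. 7 of arXiv
math/0109120), whereas the discrete arm calculus of the tree (separation `sepFourArm`, gluing,
Kesten's relations; `ArmSeparationFourArm(Proofs).lean`, `NearCriticalFourArmQuasiMult.lean`,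
`AltFourArm.lean`) is, as in the literature (Kesten 1987 (1.12); Nolin 2008, §4, `A_{j,σ}` with
`σ = BWBW`; Werner 2009, Lecture 6, `π̂`), about ONE cyclic pattern at a time — the ALTERNATING one,
`altFourArm r R` (cluster form, `AltFourArm.lean`).

This file supplies the missing joint. With four arms of colours `T, F, T, F` there are two cyclic
arrangements, alternating `BWBW` and adjacent `BBWW`, and Smirnov–Werner's "up to a multiplicative
constant" is P. Nolin's colour-exchange proposition (*Near-critical percolation in two dimensions*,
EJP **13** (2008), §5.1, Prop. 20 [arXiv 0711.4948: Prop. 19]: "If `σ, σ' ∈ 𝔖_j` are two non-constant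
color sequences, then `P_{1/2}(A_{j,σ}(n,N)) ≍ P_{1/2}(A_{j,σ'}(n,N))`", proved from the
arm-separation Thm. 11 [arXiv Thm. 10] — "we are allowed to condition on the black arm arriving on `I₁`
and on the white arm arriving on `I₂` that are closest to each other … determined via an exploration
process … We can then 'flip' the remaining region" — after Aizenman–Duplantier–Aharony 1999).

* `adjFourArm r R` — **the adjacent arrangement, cluster form**: the data of
  `armEvent ![T,F,T,F] r R` such that the two open arms ARE joined by an open path of the closed
  annulus `{r ≤ |·| ≤ R}` or the two closed arms by a closed path of it — the complement, witness by
  witness, of the two separation clauses of `altFourArm`; hence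
  `armEvent_four_eq_alt_union_adj : armEvent ![T,F,T,F] r R = altFourArm r R ∪ adjFourArm r R`
  (by excluded middle, no planar topology) and the union bound
  `critFourArmProb_le_alt_add_adj : π₄(r, R) ≤ P_{1/2}(altFourArm r R) + P_{1/2}(adjFourArm r R)`;
  locality (`determinedBy_adjFourArm`), colour flip (`compl_preimage_adjFourArm`).
* `landedFourAdj r R` — **four plain arms in the adjacent arrangement landed on prescribed sides of
  `∂Λ_R`**: open arms ending on the sides `0 = {x₀ = R}` and `1 = {x₀ + x₁ = R}`, closed arms on the
  sides `3 = {x₀ = -R}` and `4 = {x₀ + x₁ = -R}` (Nolin 2008, §4.2, the event `Ā^{·/I}_{4,BBWW}` with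
  landing areas `I = (side 0, side 1, side 3, side 4)` and no free spaces), the input format of the
  colour-exchange flip; `landedFourAdj_subset_armEvent`, non-vacuity
  (`quadrant_mem_landedFourAdj`, `quadrant_mem_adjFourArm`, `triSitePercolation_landedFourAdj_pos`,
  `triSitePercolation_adjFourArm_pos`: the configuration "open = closed first quadrant").
* **Assembly** (PROVED implications between explicitly displayed hypotheses; no named fact is
  introduced, D-0026):
  - `critFourArm_separation_of_alt` — alternating separation at `p = 1/2`
    (`c · P_{1/2}(altFourArm n N) ≤ P_{1/2}(sepFourArm n N)`, Nolin Thm. 11 for `j = 4`, `σ = BWBW`,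
    the `t = 1/2` slice of the near-critical hypothesis of `PivotalLowerBoundAlt.lean`,
    `critAltFourArm_separation_of_nearCritical`) AND the bridge
    `c' · π₄(n, N) ≤ P_{1/2}(altFourArm n N)` (Nolin Prop. 20 for `BWBW` vs `BBWW`) give the
    separation hypothesis of `fourArm_exponent_of_separation` (`ArmSeparationFourArmProofs.lean`);
  - `fourArm_bridge_of_landing_of_flip` — the bridge from its two printed halves: LANDING of the
    adjacent arrangement, `c · P_{1/2}(adjFourArm n N) ≤ P_{1/2}(landedFourAdj n N)` (Nolin Thm. 11
    for `σ = BBWW`: `P(Ã̃^{I}) ≍ P(A)`, and `Ã̃ ⊆ Ā`), and the FLIP,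
    `P_{1/2}(landedFourAdj n N) ≤ C · P_{1/2}(altFourArm n N)` (the exploration/stopping-set step of
    the proof of Prop. 20: flipping the region beyond the interface from the junction of sides `1`
    and `3` exchanges the colours of the arms on sides `0` and `4`, producing the alternating
    arrangement; Smirnov's colour switching, Bollobás–Riordan 2006, Ch. 7, Lemma 6);
  - `fourArm_exponent_of_altSeparation`, `fourArm_exponent_of_altSeparation_of_flip`,
    `fourArm_exponent_of_scalingLimit_of_nearCritical_altSeparation` — **`fourArm_exponent` from
    SW's two continuum inputs ((16)ℕ: `π₄(ρ r, ρ R) → L(r, R)`; (9)ℕ: `log L(1, n)/log n → -5/4`),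
    alternating separation, and the bridge (or landing + flip)**. After this file the discrete
    inputs of `fourArm_exponent_holds` are stated per colour pattern, in the form in which Nolin's
    §4–§5 proves them and in which the near-critical programme consumes separation.

Why the bridge cannot be dispensed with for the order-free fact: any separation theorem lands the
arms in the cyclic order it finds them, and arms glued across two annuli keep their cyclic pattern
(planarity), so quasi-multiplicativity of the order-free `π₄` (SW (10)) needs the comparison of the
two arrangements — SW's parenthetical "we will justify this rigorously later", Remark 6 and (21).

## References

* S. Smirnov, W. Werner, *Critical exponents for two-dimensional percolation*, Math. Res. Lett. 8
  (2001) 729–744, §4 (p. 7 of arXiv math/0109120: `H_j(r,R)`, "prescribe colours … and their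
  order … up to a multiplicative constant"), Thm. 4, Remark 6, (10), (16), (21)
  [SmirnovWernerMRL2001].
* P. Nolin, *Near-critical percolation in two dimensions*, Electron. J. Probab. 13 (2008)
  1562–1623, §4.1 (`A_{j,σ}`, cyclic order), §4.2 (Def. 8, `Ā^{I/I'}`), Thm. 11, §5.1 Prop. 19–20
  (arXiv 0711.4948: Thm. 10, Prop. 18–19, p. 15) [Nolin2008].
* M. Aizenman, B. Duplantier, A. Aharony, *Path-crossing exponents and the external perimeter in
  2D percolation*, Phys. Rev. Lett. 83 (1999) 1359 (colour exchange) [AizenmanDuplantierAharony1999].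
* W. Werner, *Lectures on two-dimensional critical percolation*, IAS/Park City Math. Ser. 16
  (2009), Lecture 5 §4 ("changing the prescribed order of the colors around the circle does not
  change the exponents … one can switch all colors in the complementary domain"), Lecture 6 §4
  (`π̂_p`) [WernerPCMI2009].
* B. Bollobás, O. Riordan, *Percolation*, CUP (2006), Ch. 7, Lemma 6 (colour switching)
  [BollobasRiordan2006].
* H. Kesten, *Scaling relations for 2D-percolation*, Comm. Math. Phys. 109 (1987), §1 (1.12)
  [KestenScalingCMP1987].

Tree: `altFourArm`, `altFourArmProbAt`, `triAnn`, `altFourArm_subset_armEvent`,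
`triAnn_inter_eq_of_agree`, `triAnn_diff_eq_of_agree`, `vecTFTF_succ` (`AltFourArm.lean`);
`armEvent`, `IsColouredPath`, `polyArmProb` (`ArmEvents.lean`), `critFourArmProb`
(`KestenScaling.lean`), `fourArmProbAt`, `fourArmProbAt_half` (`WernerPivotalEstimates.lean`),
`charLengthW` (`WernerCorrelationLength.lean`), `sepFourArm` (`ArmSeparationFourArm.lean`),
`fourArm_exponent_of_separation` (`ArmSeparationFourArmProofs.lean`), `FourArmPos.rayPt/rayWalk`
(`ArmExponentsFourArm.lean`), `TwoArmPos.triSitePercolation_half_cylinder_pos`,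
`mem_triAnnulus_of_arm` (`ArmEventsProofs.lean`), `isColouredPath_compl_iff`
(`ArmEventsStructure.lean`), `PathIn` (`SitePaths.lean`), `triNorm_eq_of_apply_eq`,
`triGraph_adj_iff_coord`. Mathlib: `MeasureTheory.measureReal_union_le`, `SimpleGraph.Walk`.
-/

noncomputable section

open Set MeasureTheory Filter Topology
open scoped unitInterval

namespace Literature.Probability.Percolation

open LatticeModels

/-! ### The adjacent arrangement (cluster form) and the decomposition of the order-free event -/

/-- **The four-arm event in the adjacent arrangement, cluster form.** The data of
`armEvent ![true, false, true, false] r R` — four pairwise vertex-disjoint self-avoiding arms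
`w 0, …, w 3` across `Λ_R ∖ Λ_r`, of colours open, closed, open, closed — such that the two open
arms ARE joined by an open path of the closed annulus `{r ≤ |·| ≤ R}`, or the two closed arms by a
closed path of it. This is the witness-wise complement of the two clauses of `altFourArm r R`
(`AltFourArm.lean`): an open path between the open arms cannot cross a closed arm, so such a
family is in the cyclic order `BBWW` (Nolin 2008, §4.1: "the two sequences `BWBW` and `WBWB` are
the same, but they are different from `BBWW`"); conversely every family of four arms is
alternating or adjacent in this sense (`armEvent_four_eq_alt_union_adj`). [cite: Nolin2008, §4.1 (arXiv 0711.4948, §4.1: colour sequences up to cyclic permutation)] -/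
def adjFourArm (r R : ℕ) : Set (SiteConfig (Site 2)) :=
  {ω | ∃ (x y : Fin 4 → Site 2) (w : ∀ j, triGraph.Walk (x j) (y j)),
    (∀ j, x j ∈ triSphere r ∧ y j ∈ triSphere R ∧ (w j).IsPath ∧
      (∀ v ∈ (w j).support, v ∈ (↑(triBall R) : Set (Site 2)) \ ↑(triBall r) ∨ v ∈ triSphere r) ∧
      IsColouredPath ω (![true, false, true, false] j) (w j)) ∧
    (Pairwise fun i j => Disjoint (w i).support.toFinset (w j).support.toFinset) ∧
    ((∃ u ∈ (w 0).support, ∃ v ∈ (w 2).support, PathIn triGraph (triAnn r R ∩ ω) u v) ∨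
      (∃ u ∈ (w 1).support, ∃ v ∈ (w 3).support, PathIn triGraph (triAnn r R \ ω) u v))}

/-- The adjacent arrangement is contained in the order-free four-arm event. [cite: Nolin2008, §4.1] -/
theorem adjFourArm_subset_armEvent (r R : ℕ) :
    adjFourArm r R ⊆ armEvent ![true, false, true, false] r R := by
  rintro ω ⟨x, y, w, hw, hdisj, -⟩
  exact ⟨x, y, w, hw, hdisj⟩

/-- **The order-free four-arm event is the union of its two arrangements**:
`armEvent ![T,F,T,F] r R = altFourArm r R ∪ adjFourArm r R` — every family of four arms either
satisfies both separation clauses of `altFourArm` or violates one of them (excluded middle; the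
two arrangements may overlap as events, different families of the same configuration being
allowed). (Smirnov–Werner 2001, §4: `H_j` versus prescribed order; Nolin 2008, §4.1.) [cite: SmirnovWernerMRL2001, §4 (H_j(r,R), p. 7 of arXiv math/0109120)] [cite: Nolin2008, §4.1] -/
theorem armEvent_four_eq_alt_union_adj (r R : ℕ) :
    armEvent ![true, false, true, false] r R = altFourArm r R ∪ adjFourArm r R := by
  refine Set.Subset.antisymm ?_
    (Set.union_subset (altFourArm_subset_armEvent r R) (adjFourArm_subset_armEvent r R))
  rintro ω ⟨x, y, w, hw, hdisj⟩
  by_cases h : (∃ u ∈ (w 0).support, ∃ v ∈ (w 2).support, PathIn triGraph (triAnn r R ∩ ω) u v) ∨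
      (∃ u ∈ (w 1).support, ∃ v ∈ (w 3).support, PathIn triGraph (triAnn r R \ ω) u v)
  · exact Or.inr ⟨x, y, w, hw, hdisj, h⟩
  · refine Or.inl ⟨x, y, w, hw, hdisj, ?_, ?_⟩
    · exact fun u hu v hv hp => h (Or.inl ⟨u, hu, v, hv, hp⟩)
    · exact fun u hu v hv hp => h (Or.inr ⟨u, hu, v, hv, hp⟩)

/-- `π₄(r, R)` is the `P_{1/2}`-probability of the order-free four-arm event. [cite: SmirnovWernerMRL2001, §4] -/
theorem critFourArmProb_eq_real (r R : ℕ) :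
    critFourArmProb r R = (triSitePercolation half).real (armEvent ![true, false, true, false] r R) :=
  rfl

/-- `π̂^alt_{1/2}(r, R)` is the `P_{1/2}`-probability of the alternating event. [cite: WernerPCMI2009, Lecture 6, §4] -/
theorem altFourArmProbAt_half (r R : ℕ) :
    altFourArmProbAt half r R = (triSitePercolation half).real (altFourArm r R) :=
  rfl

/-- **Union bound over the two arrangements**:
`π₄(r, R) ≤ P_{1/2}(altFourArm r R) + P_{1/2}(adjFourArm r R)`. [cite: SmirnovWernerMRL2001, §4 (prescribing the order changes b_j up to a multiplicative constant)] -/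
theorem critFourArmProb_le_alt_add_adj (r R : ℕ) :
    critFourArmProb r R ≤ (triSitePercolation half).real (altFourArm r R) +
      (triSitePercolation half).real (adjFourArm r R) := by
  rw [critFourArmProb_eq_real, armEvent_four_eq_alt_union_adj]
  exact measureReal_union_le _ _

/-- `P_{1/2}(altFourArm r R) ≤ π₄(r, R)`. [cite: Nolin2008, §4.1] -/
theorem real_altFourArm_le_critFourArmProb (r R : ℕ) :
    (triSitePercolation half).real (altFourArm r R) ≤ critFourArmProb r R :=
  measureReal_mono (altFourArm_subset_armEvent r R) (measure_ne_top _ _)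

/-- `P_{1/2}(adjFourArm r R) ≤ π₄(r, R)`. [cite: Nolin2008, §4.1] -/
theorem real_adjFourArm_le_critFourArmProb (r R : ℕ) :
    (triSitePercolation half).real (adjFourArm r R) ≤ critFourArmProb r R :=
  measureReal_mono (adjFourArm_subset_armEvent r R) (measure_ne_top _ _)

/-! ### Locality and colour flip of the adjacent arrangement -/

/-- **The adjacent arrangement is determined by the sites of the annulus** `triAnnulus r R` (the
arms lie in it, `mem_triAnnulus_of_arm`, and the joining clause only mentions paths of it). [cite: SmirnovWernerMRL2001, §3] -/
theorem adjFourArm_determined {r R : ℕ} (hrR : r ≤ R) (ω ω' : SiteConfig (Site 2))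
    (h : ∀ v ∈ triAnnulus r R, (v ∈ ω ↔ v ∈ ω')) : ω ∈ adjFourArm r R ↔ ω' ∈ adjFourArm r R := by
  have hi := triAnn_inter_eq_of_agree h
  have hd := triAnn_diff_eq_of_agree h
  constructor
  · rintro ⟨x, y, w, hw, hdisj, hc⟩
    refine ⟨x, y, w, fun j => ?_, hdisj, ?_⟩
    · obtain ⟨hx, hy, hpath, hsupp, hcol⟩ := hw j
      exact ⟨hx, hy, hpath, hsupp, fun v hv =>
        (h v (mem_triAnnulus_of_arm hrR (hsupp v hv))).symm.trans (hcol v hv)⟩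
    · rw [← hi, ← hd]; exact hc
  · rintro ⟨x, y, w, hw, hdisj, hc⟩
    refine ⟨x, y, w, fun j => ?_, hdisj, ?_⟩
    · obtain ⟨hx, hy, hpath, hsupp, hcol⟩ := hw j
      exact ⟨hx, hy, hpath, hsupp, fun v hv =>
        (h v (mem_triAnnulus_of_arm hrR (hsupp v hv))).trans (hcol v hv)⟩
    · rw [hi, hd]; exact hc

/-- `DeterminedBy` form of `adjFourArm_determined`. [cite: SmirnovWernerMRL2001, §3] -/
theorem determinedBy_adjFourArm {r R : ℕ} (hrR : r ≤ R) :
    DeterminedBy (adjFourArm r R) ↑(triAnnulus r R) := by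
  rw [determinedBy_iff]
  intro ω ω' h
  refine adjFourArm_determined hrR ω ω' fun v hv => ?_
  have hv' : v ∈ (↑(triAnnulus r R) : Set (Site 2)) := Finset.mem_coe.2 hv
  have key := Set.ext_iff.1 h v
  exact ⟨fun hω => (key.1 ⟨hω, hv'⟩).1, fun hω' => (key.2 ⟨hω', hv'⟩).1⟩

/-- The adjacent arrangement is measurable. [cite: SmirnovWernerMRL2001, §3] -/
theorem measurableSet_adjFourArm {r R : ℕ} (hrR : r ≤ R) : MeasurableSet (adjFourArm r R) :=
  (determinedBy_adjFourArm hrR).measurableSet_of_finset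

/-- **Colour flip = cyclic relabelling** for the adjacent arrangement: complementing the
configuration and reading the arms one step further (`j ↦ w (j + 1)`) maps `adjFourArm` to itself
(a joining open path between the open arms of `ω` is a joining closed path between the closed arms
of `ωᶜ`, and conversely). [cite: SmirnovWernerMRL2001, Rem. 2] -/
theorem compl_mem_adjFourArm {r R : ℕ} {ω : SiteConfig (Site 2)} (hω : ω ∈ adjFourArm r R) :
    ωᶜ ∈ adjFourArm r R := by
  obtain ⟨x, y, w, hw, hdisj, hc⟩ := hω
  refine ⟨fun j => x (j + 1), fun j => y (j + 1), fun j => w (j + 1), fun j => ?_, ?_, ?_⟩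
  · obtain ⟨hx, hy, hpath, hsupp, hcol⟩ := hw (j + 1)
    refine ⟨hx, hy, hpath, hsupp, ?_⟩
    rw [isColouredPath_compl_iff, ← vecTFTF_succ]
    exact hcol
  · intro i j hij
    exact hdisj fun h => hij (by simpa using h)
  · rcases hc with ⟨u, hu, v, hv, hp⟩ | ⟨u, hu, v, hv, hp⟩
    · -- the open arms `w 0`, `w 2` of `ω` are the closed arms `j = 3`, `j = 1` of `ωᶜ`
      refine Or.inr ⟨v, hv, u, hu, (hp.mono fun z hz => ?_).symm⟩
      simp only [Set.mem_sdiff, Set.mem_compl_iff, not_not]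
      exact ⟨hz.1, hz.2⟩
    · -- the closed arms `w 1`, `w 3` of `ω` are the open arms `j = 0`, `j = 2` of `ωᶜ`
      refine Or.inl ⟨u, hu, v, hv, hp.mono fun z hz => ?_⟩
      exact ⟨hz.1, hz.2⟩

/-- `compl ⁻¹' adjFourArm r R = adjFourArm r R`. [cite: SmirnovWernerMRL2001, Rem. 2] -/
theorem compl_preimage_adjFourArm (r R : ℕ) : compl ⁻¹' adjFourArm r R = adjFourArm r R := by
  ext ω
  refine ⟨fun h => ?_, fun h => compl_mem_adjFourArm h⟩
  have := compl_mem_adjFourArm (ω := ωᶜ) h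
  rwa [compl_compl] at this

/-! ### Plain arms in the adjacent arrangement landed on prescribed sides -/

/-- **Four plain arms in the adjacent arrangement, landed on the sides `0, 1, 3, 4` of `∂Λ_R`**
(Nolin 2008, §4.2, Def. 8 and the event `Ā^{·/I}_{j,σ}(n, N)`: "we impose the landing areas `I` of
the different arms without requiring the existence of the free spaces", here `j = 4`, `σ = BBWW`
and `I` = the four whole sides): the data of `armEvent ![T,F,T,F] r R` whose open arms (`j = 0, 2`)
end on the sides `{x₀ = R}` and `{x₀ + x₁ = R}` of the hexagon `∂Λ_R` and whose closed arms
(`j = 1, 3`) end on the sides `{x₀ = -R}` and `{x₀ + x₁ = -R}`; in counterclockwise order of the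
sides `0, 1, 3, 4` the colours read `B B W W`. Inner extremities are free. This is the input of the
colour-exchange flip (Nolin 2008, §5.1, proof of Prop. 20: the exploration process is started at a
boundary point between the landing areas of a black and a white arm — here the middle of side
`2`). [cite: Nolin2008, §4.2 Def. 8 (arXiv 0711.4948: the events Ā^{I/I'})] -/
def landedFourAdj (r R : ℕ) : Set (SiteConfig (Site 2)) :=
  {ω | ∃ (x y : Fin 4 → Site 2) (w : ∀ j, triGraph.Walk (x j) (y j)),
    (∀ j, x j ∈ triSphere r ∧ y j ∈ triSphere R ∧ (w j).IsPath ∧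
      (∀ v ∈ (w j).support, v ∈ (↑(triBall R) : Set (Site 2)) \ ↑(triBall r) ∨ v ∈ triSphere r) ∧
      IsColouredPath ω (![true, false, true, false] j) (w j)) ∧
    (Pairwise fun i j => Disjoint (w i).support.toFinset (w j).support.toFinset) ∧
    (y 0 0 = R ∧ y 2 0 + y 2 1 = R ∧ y 1 0 = -(R : ℤ) ∧ y 3 0 + y 3 1 = -(R : ℤ))}

/-- Landed adjacent arms are four arms. [cite: Nolin2008, §4.2 (Ā ⊆ A)] -/
theorem landedFourAdj_subset_armEvent (r R : ℕ) :
    landedFourAdj r R ⊆ armEvent ![true, false, true, false] r R := by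
  rintro ω ⟨x, y, w, hw, hdisj, -⟩
  exact ⟨x, y, w, hw, hdisj⟩

/-- `P_{1/2}(landedFourAdj r R) ≤ π₄(r, R)`. [cite: Nolin2008, §4.2 (Ā ⊆ A)] -/
theorem real_landedFourAdj_le_critFourArmProb (r R : ℕ) :
    (triSitePercolation half).real (landedFourAdj r R) ≤ critFourArmProb r R :=
  measureReal_mono (landedFourAdj_subset_armEvent r R) (measure_ne_top _ _)

/-! ### Non-vacuity: the quadrant configuration

The configuration whose open sites are those of the closed first quadrant `{x₀ ≥ 0, x₁ ≥ 0}`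
carries the open rays `{t e₀}`, `{t e₁}` and the closed rays `{-t e₀}`, `{-t e₁}` (`r ≤ t ≤ R`),
four pairwise disjoint arms ending at `R e₀ ∈ {x₀ = R}`, `R e₁ ∈ {x₀ + x₁ = R}`,
`-R e₀ ∈ {x₀ = -R}`, `-R e₁ ∈ {x₀ + x₁ = -R}`, and the open diagonal `(r - k) e₀ + k e₁` of `∂Λ_r`
joining the two open rays inside the annulus: it lies in `landedFourAdj r R ∩ adjFourArm r R`, and
prescribing these finitely many sites is a cylinder event of positive probability (Nolin 2008, §4.1,
`n₀(j)`: "we can then draw straight lines heading toward the exterior"). -/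

namespace FourArmAdjPos

open FourArmPos

/-- Axis of the `j`-th ray of the adjacent configuration: `e₀, e₀, e₁, e₁`. [folklore] -/
def dirA : Fin 4 → Fin 2 := ![0, 0, 1, 1]

/-- Orientation of the `j`-th ray of the adjacent configuration: `+, -, +, -`. [folklore] -/
def sgnA : Fin 4 → ℤ := ![1, -1, 1, -1]

/-- Each orientation is `±1`. [folklore] -/
theorem sgnA_eq (j : Fin 4) : sgnA j = 1 ∨ sgnA j = -1 := by
  fin_cases j <;> simp [sgnA]

/-- `|sgnA j| = 1`. [folklore] -/
theorem abs_sgnA (j : Fin 4) : |sgnA j| = 1 := by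
  rcases sgnA_eq j with h | h <;> simp [h]

/-- The four rays `+e₀, -e₀, +e₁, -e₁` are distinct: `(dirA, sgnA)` is injective. [folklore] -/
theorem eq_of_dirA_eq_of_sgnA_eq {j j' : Fin 4} (hd : dirA j = dirA j') (hs : sgnA j = sgnA j') :
    j = j' := by
  fin_cases j <;> fin_cases j' <;> simp_all [dirA, sgnA]

/-- The graph norm of the `k`-th site of the `j`-th ray started at radius `r` is `r + k`. [folklore] -/
theorem triNorm_rayA (j : Fin 4) (r k : ℕ) :
    triNorm (rayPt (dirA j) (sgnA j * ((r : ℤ) + k))) = r + k := by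
  rw [triNorm_rayPt, abs_mul, abs_sgnA, one_mul]
  exact abs_of_nonneg (by positivity)

/-- **The rays are coloured `TFTF` by the quadrant**: a site of the `j`-th ray (beyond the origin)
lies in the closed first quadrant iff `j ∈ {0, 2}`. [folklore] -/
theorem quadrant_ray_iff (j : Fin 4) {r : ℕ} (k : ℕ) (hr : 1 ≤ r) :
    (0 ≤ rayPt (dirA j) (sgnA j * ((r : ℤ) + k)) 0 ∧ 0 ≤ rayPt (dirA j) (sgnA j * ((r : ℤ) + k)) 1) ↔
      (![true, false, true, false] : Fin 4 → Bool) j = true := by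
  have h1 : (1 : ℤ) ≤ r + k := by
    have : (1 : ℤ) ≤ r := by exact_mod_cast hr
    linarith
  fin_cases j
  · simp [dirA, sgnA, rayPt]; linarith
  · simp [dirA, sgnA, rayPt]; linarith
  · simp [dirA, sgnA, rayPt]; linarith
  · simp [dirA, sgnA, rayPt]; linarith

/-- The `k`-th site `(r - k) e₀ + k e₁` of the diagonal `{x₀ + x₁ = r, x₀, x₁ ≥ 0} ⊆ ∂Λ_r`. [folklore] -/
def conn (r k : ℕ) : Site 2 := ![(r : ℤ) - k, k]

/-- First coordinate of `conn r k`. [folklore] -/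
@[simp] theorem conn_apply_zero (r k : ℕ) : conn r k 0 = (r : ℤ) - k := rfl

/-- Second coordinate of `conn r k`. [folklore] -/
@[simp] theorem conn_apply_one (r k : ℕ) : conn r k 1 = k := rfl

/-- The diagonal lies on `∂Λ_r`. [folklore] -/
theorem triNorm_conn {r k : ℕ} (hk : k ≤ r) : triNorm (conn r k) = r := by
  have := triNorm_eq_of_apply_eq (y := conn r k) (conn_apply_zero r k) (conn_apply_one r k)
  omega

/-- The diagonal starts at `r e₀`. [folklore] -/
theorem conn_zero (r : ℕ) : conn r 0 = rayPt 0 r := by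
  ext i; fin_cases i <;> simp [conn, rayPt]

/-- The diagonal ends at `r e₁`. [folklore] -/
theorem conn_self (r : ℕ) : conn r r = rayPt 1 r := by
  ext i; fin_cases i <;> simp [conn, rayPt]

/-- Consecutive sites of the diagonal are adjacent in `𝕋` (the step `-e₀ + e₁`). [folklore] -/
theorem triGraph_adj_conn (r k : ℕ) : triGraph.Adj (conn r k) (conn r (k + 1)) := by
  rw [triGraph_adj_iff_coord]
  simp only [conn_apply_zero, conn_apply_one]
  push_cast
  omega

/-- The diagonal is a path inside any set containing its sites. [folklore] -/
theorem pathIn_conn {A : Set (Site 2)} {r : ℕ} (hA : ∀ k ≤ r, conn r k ∈ A) :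
    ∀ k ≤ r, PathIn triGraph A (conn r 0) (conn r k)
  | 0, _ => PathIn.refl (hA 0 (Nat.zero_le _))
  | k + 1, hk => (pathIn_conn hA k (Nat.le_of_succ_le hk)).tail (triGraph_adj_conn r k) (hA (k + 1) hk)

/-- **Non-vacuity of the landed adjacent arrangement (jointly with the cluster form).** For
`1 ≤ r ≤ R` the event `landedFourAdj r R ∩ adjFourArm r R` has positive `P_{1/2}`-probability: the
cylinder event "the sites of the four rays `±t e₀, ±t e₁` (`r ≤ t ≤ R`) and of the diagonal of
`∂Λ_r` between `r e₀` and `r e₁` are open iff they lie in the closed first quadrant" is contained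
in it. (Nolin 2008, §4.1, `A_{j,σ}(n₀(j), N) ≠ ∅` by straight rays.) [cite: Nolin2008, §4.1 (n₀(j))] -/
theorem triSitePercolation_landedFourAdj_inter_adjFourArm_pos {r R : ℕ} (hr : 1 ≤ r) (hrR : r ≤ R) :
    0 < (triSitePercolation half).real (landedFourAdj r R ∩ adjFourArm r R) := by
  classical
  obtain ⟨n, rfl⟩ : ∃ n : ℕ, R = r + n := ⟨R - r, by omega⟩
  set κ : Fin 4 → Bool := ![true, false, true, false] with hκ
  -- the four rays, uniformly in `j`
  set W : ∀ j : Fin 4, triGraph.Walk (rayPt (dirA j) (sgnA j * r)) (rayPt (dirA j) (sgnA j * r + n * sgnA j)) :=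
    fun j => rayWalk (dirA j) (sgnA j) (sgnA_eq j) (sgnA j * r) n with hW
  -- sites of the rays
  have hmemW : ∀ j, ∀ v ∈ (W j).support, ∃ k : ℕ, k ≤ n ∧ v = rayPt (dirA j) (sgnA j * ((r : ℤ) + k)) := by
    intro j v hv
    obtain ⟨k, hk, rfl⟩ := mem_support_rayWalk.1 hv
    exact ⟨k, hk, by congr 1; ring⟩
  -- two rays meet only if they are the same ray
  have hdisj : ∀ j j', ∀ v, v ∈ (W j).support → v ∈ (W j').support → j = j' := by
    intro j j' v hv hv'
    obtain ⟨k, -, rfl⟩ := hmemW j v hv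
    obtain ⟨k', -, hkk'⟩ := hmemW j' _ hv'
    have hr1 : (1 : ℤ) ≤ r := by exact_mod_cast hr
    have hne : sgnA j * ((r : ℤ) + k) ≠ 0 := by
      rcases sgnA_eq j with h | h <;> · rw [h]; intro h0; nlinarith
    obtain ⟨hd, hs⟩ := rayPt_inj hkk' hne
    rcases sgnA_eq j with h | h <;> rcases sgnA_eq j' with h' | h'
    · exact eq_of_dirA_eq_of_sgnA_eq hd (h.trans h'.symm)
    · exfalso; rw [h, h'] at hs; nlinarith
    · exfalso; rw [h, h'] at hs; nlinarith
    · exact eq_of_dirA_eq_of_sgnA_eq hd (h.trans h'.symm)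
  -- the cylinder event: the sites of the rays and of the diagonal, coloured by the quadrant
  set S : Finset (Site 2) := (Finset.univ.biUnion fun j => (W j).support.toFinset) ∪
    (Finset.range (r + 1)).image (conn r) with hS
  set b : Site 2 → Prop := fun v => 0 ≤ v 0 ∧ 0 ≤ v 1 with hb
  have hcyl : {ω : SiteConfig (Site 2) | ∀ v ∈ S, (v ∈ ω ↔ b v)} ⊆
      landedFourAdj r (r + n) ∩ adjFourArm r (r + n) := by
    intro ω hω
    simp only [Set.mem_setOf_eq] at hω
    -- the common arm data
    have hw : ∀ j, rayPt (dirA j) (sgnA j * r) ∈ triSphere r ∧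
        rayPt (dirA j) (sgnA j * r + n * sgnA j) ∈ triSphere (r + n) ∧ (W j).IsPath ∧
        (∀ v ∈ (W j).support, v ∈ (↑(triBall (r + n)) : Set (Site 2)) \ ↑(triBall r) ∨ v ∈ triSphere r) ∧
        IsColouredPath ω (κ j) (W j) := by
      intro j
      refine ⟨?_, ?_, isPath_rayWalk _ _ _ _ _, fun v hv => ?_, fun v hv => ?_⟩
      · rw [mem_triSphere_iff]
        have := triNorm_rayA j r 0
        simpa using this
      · rw [mem_triSphere_iff]
        have := triNorm_rayA j r n
        rw [show sgnA j * ((r : ℤ) + n) = sgnA j * r + n * sgnA j by ring] at this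
        rw [this]
        push_cast
        ring
      · obtain ⟨k, hk, rfl⟩ := hmemW j v hv
        rcases Nat.eq_zero_or_pos k with rfl | hk0
        · right
          rw [mem_triSphere_iff, triNorm_rayA]
          simp
        · left
          simp only [Set.mem_sdiff, Finset.mem_coe, mem_triBall_iff, triNorm_rayA, not_le]
          constructor
          · push_cast; linarith
          · exact_mod_cast Nat.lt_add_of_pos_right hk0
      · have hvS : v ∈ S := by
          rw [hS, Finset.mem_union, Finset.mem_biUnion]
          exact Or.inl ⟨j, Finset.mem_univ _, List.mem_toFinset.2 hv⟩
        rw [hω v hvS]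
        obtain ⟨k, -, rfl⟩ := hmemW j v hv
        exact quadrant_ray_iff j k hr
    have hpair : Pairwise fun i j => Disjoint (W i).support.toFinset (W j).support.toFinset := by
      intro i j hij
      exact Finset.disjoint_left.2 fun v hvi hvj =>
        hij (hdisj i j v (List.mem_toFinset.1 hvi) (List.mem_toFinset.1 hvj))
    -- the diagonal is an open path of the annulus from `r e₀` to `r e₁`
    have hconn : ∀ k ≤ r, conn r k ∈ triAnn r (r + n) ∩ ω := by
      intro k hk
      refine ⟨?_, ?_⟩
      · rw [mem_triAnn, triNorm_conn hk]
        constructor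
        · exact le_rfl
        · exact_mod_cast Nat.le_add_right r n
      · have hkS : conn r k ∈ S := by
          rw [hS, Finset.mem_union, Finset.mem_image]
          exact Or.inr ⟨k, Finset.mem_range.2 (Nat.lt_succ_of_le hk), rfl⟩
        rw [hω _ hkS, hb]
        simp only [conn_apply_zero, conn_apply_one]
        omega
    have hpath : PathIn triGraph (triAnn r (r + n) ∩ ω) (rayPt (dirA 0) (sgnA 0 * r)) (rayPt (dirA 2) (sgnA 2 * r)) := by
      have h0 : rayPt (dirA 0) (sgnA 0 * r) = conn r 0 := by
        rw [conn_zero]; simp [dirA, sgnA]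
      have h2 : rayPt (dirA 2) (sgnA 2 * r) = conn r r := by
        rw [conn_self]; simp [dirA, sgnA]
      rw [h0, h2]
      exact pathIn_conn hconn r le_rfl
    refine ⟨⟨fun j => rayPt (dirA j) (sgnA j * r), fun j => rayPt (dirA j) (sgnA j * r + n * sgnA j), W,
        hw, hpair, ?_, ?_, ?_, ?_⟩,
      ⟨fun j => rayPt (dirA j) (sgnA j * r), fun j => rayPt (dirA j) (sgnA j * r + n * sgnA j), W,
        hw, hpair, Or.inl ⟨_, (W 0).start_mem_support, _, (W 2).start_mem_support, hpath⟩⟩⟩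
    · simp [dirA, sgnA, rayPt]
    · simp [dirA, sgnA, rayPt]
    · simp [dirA, sgnA, rayPt]; ring
    · simp [dirA, sgnA, rayPt]; ring
  calc (0 : ℝ) < (triSitePercolation half).real {ω : SiteConfig (Site 2) | ∀ v ∈ S, (v ∈ ω ↔ b v)} :=
        TwoArmPos.triSitePercolation_half_cylinder_pos S b
    _ ≤ (triSitePercolation half).real (landedFourAdj r (r + n) ∩ adjFourArm r (r + n)) :=
        measureReal_mono hcyl (measure_ne_top _ _)

end FourArmAdjPos

/-- **The landed adjacent arrangement has positive probability** for `1 ≤ r ≤ R` (sanity check of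
the landing hypothesis `c · P(adjFourArm) ≤ P(landedFourAdj)`). [cite: Nolin2008, §4.1 (n₀(j))] -/
theorem triSitePercolation_landedFourAdj_pos {r R : ℕ} (hr : 1 ≤ r) (hrR : r ≤ R) :
    0 < (triSitePercolation half).real (landedFourAdj r R) :=
  lt_of_lt_of_le (FourArmAdjPos.triSitePercolation_landedFourAdj_inter_adjFourArm_pos hr hrR)
    (measureReal_mono Set.inter_subset_left (measure_ne_top _ _))

/-- **The adjacent arrangement has positive probability** for `1 ≤ r ≤ R` (so that the bridge
`c · π₄ ≤ P(altFourArm)` is not the trivial consequence of `adjFourArm = ∅`). [cite: Nolin2008, §4.1 (n₀(j))] -/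
theorem triSitePercolation_adjFourArm_pos {r R : ℕ} (hr : 1 ≤ r) (hrR : r ≤ R) :
    0 < (triSitePercolation half).real (adjFourArm r R) :=
  lt_of_lt_of_le (FourArmAdjPos.triSitePercolation_landedFourAdj_inter_adjFourArm_pos hr hrR)
    (measureReal_mono Set.inter_subset_right (measure_ne_top _ _))

/-! ### Assembly: separation per pattern and the bridge -/

/-- **Separation for the order-free event from alternating separation and the bridge.** IF the
well-separated alternating event is comparable to the alternating event at `p = 1/2`,
`c · P_{1/2}(altFourArm n N) ≤ P_{1/2}(sepFourArm n N)` for `n₀ ≤ n`, `2n ≤ N` (Nolin 2008, Thm. 11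
for `j = 4`, `σ = BWBW` [arXiv Thm. 10]), AND the order-free four-arm probability is dominated by
the alternating one, `c' · π₄(n, N) ≤ P_{1/2}(altFourArm n N)` (Nolin 2008, Prop. 20 [arXiv
Prop. 19], `BBWW` versus `BWBW`; Smirnov–Werner 2001, §4, "up to a multiplicative constant"),
THEN the separation hypothesis of `fourArm_exponent_of_separation` holds with constant `c c'`.
[cite: Nolin2008, Thm. 11 and Prop. 20 (arXiv 0711.4948: Thm. 10, Prop. 19)] -/
theorem critFourArm_separation_of_alt
    (hAlt : ∃ c : ℝ, 0 < c ∧ ∃ n₀ : ℕ, ∀ n N : ℕ, n₀ ≤ n → 2 * n ≤ N →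
      c * (triSitePercolation half).real (altFourArm n N) ≤
        (triSitePercolation half).real (sepFourArm n N))
    (hBr : ∃ c : ℝ, 0 < c ∧ ∃ n₀ : ℕ, ∀ n N : ℕ, n₀ ≤ n → 2 * n ≤ N →
      c * critFourArmProb n N ≤ (triSitePercolation half).real (altFourArm n N)) :
    ∃ c : ℝ, 0 < c ∧ ∃ n₀ : ℕ, ∀ n N : ℕ, n₀ ≤ n → 2 * n ≤ N →
      c * critFourArmProb n N ≤ (triSitePercolation half).real (sepFourArm n N) := by
  obtain ⟨c₁, hc₁, n₁, h₁⟩ := hAlt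
  obtain ⟨c₂, hc₂, n₂, h₂⟩ := hBr
  refine ⟨c₁ * c₂, mul_pos hc₁ hc₂, max n₁ n₂, fun n N hn hnN => ?_⟩
  have hn₁ : n₁ ≤ n := le_trans (le_max_left _ _) hn
  have hn₂ : n₂ ≤ n := le_trans (le_max_right _ _) hn
  calc c₁ * c₂ * critFourArmProb n N = c₁ * (c₂ * critFourArmProb n N) := by ring
    _ ≤ c₁ * (triSitePercolation half).real (altFourArm n N) :=
        mul_le_mul_of_nonneg_left (h₂ n N hn₂ hnN) hc₁.le
    _ ≤ (triSitePercolation half).real (sepFourArm n N) := h₁ n N hn₁ hnN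

/-- **The bridge from landing and flip.** IF the adjacent arrangement can be landed on the sides
`0, 1, 3, 4` at constant cost, `c · P_{1/2}(adjFourArm n N) ≤ P_{1/2}(landedFourAdj n N)` for
`n₀ ≤ n`, `2n ≤ N` (Nolin 2008, Thm. 11 for `j = 4`, `σ = BBWW`, with `Ã̃ ⊆ Ā` [arXiv Thm. 10]),
AND the landed adjacent arrangement is dominated by the alternating event,
`P_{1/2}(landedFourAdj n N) ≤ C · P_{1/2}(altFourArm n N)` (the flip of Nolin 2008, proof of
Prop. 20 [arXiv Prop. 19]: condition on the black arm landed on side `1` and the white arm landed on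
side `3` closest to the middle of side `2`, found by an exploration process, and flip the remaining
region, which carries the arms of sides `0` and `4`; a measure-preserving involution at `p = 1/2`,
Bollobás–Riordan 2006, Ch. 7, Lemma 6), THEN `c/(c + C) · π₄(n, N) ≤ P_{1/2}(altFourArm n N)`:
`π₄ ≤ P(alt) + P(adj) ≤ P(alt) + c⁻¹ C P(alt)` (`critFourArmProb_le_alt_add_adj`).
[cite: Nolin2008, §5.1 Prop. 20 (proof) and Thm. 11 (arXiv 0711.4948: Prop. 19, Thm. 10)] [cite: BollobasRiordan2006, Ch. 7 Lemma 6] -/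
theorem fourArm_bridge_of_landing_of_flip
    (hLand : ∃ c : ℝ, 0 < c ∧ ∃ n₀ : ℕ, ∀ n N : ℕ, n₀ ≤ n → 2 * n ≤ N →
      c * (triSitePercolation half).real (adjFourArm n N) ≤
        (triSitePercolation half).real (landedFourAdj n N))
    (hFlip : ∃ C : ℝ, 0 < C ∧ ∃ n₀ : ℕ, ∀ n N : ℕ, n₀ ≤ n → 2 * n ≤ N →
      (triSitePercolation half).real (landedFourAdj n N) ≤
        C * (triSitePercolation half).real (altFourArm n N)) :
    ∃ c : ℝ, 0 < c ∧ ∃ n₀ : ℕ, ∀ n N : ℕ, n₀ ≤ n → 2 * n ≤ N →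
      c * critFourArmProb n N ≤ (triSitePercolation half).real (altFourArm n N) := by
  obtain ⟨c, hc, n₁, h₁⟩ := hLand
  obtain ⟨C, hC, n₂, h₂⟩ := hFlip
  refine ⟨c / (c + C), div_pos hc (by linarith), max n₁ n₂, fun n N hn hnN => ?_⟩
  have hn₁ : n₁ ≤ n := le_trans (le_max_left _ _) hn
  have hn₂ : n₂ ≤ n := le_trans (le_max_right _ _) hn
  set A := (triSitePercolation half).real (altFourArm n N) with hA
  have hadj : c * (triSitePercolation half).real (adjFourArm n N) ≤ C * A :=
    (h₁ n N hn₁ hnN).trans (h₂ n N hn₂ hnN)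
  have hsum : c * critFourArmProb n N ≤ (c + C) * A := by
    calc c * critFourArmProb n N
        ≤ c * (A + (triSitePercolation half).real (adjFourArm n N)) :=
          mul_le_mul_of_nonneg_left (critFourArmProb_le_alt_add_adj n N) hc.le
      _ = c * A + c * (triSitePercolation half).real (adjFourArm n N) := by ring
      _ ≤ c * A + C * A := by linarith
      _ = (c + C) * A := by ring
  have hcC : 0 < c + C := by linarith
  calc c / (c + C) * critFourArmProb n N = (c * critFourArmProb n N) / (c + C) := by ring
    _ ≤ ((c + C) * A) / (c + C) := div_le_div_of_nonneg_right hsum hcC.le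
    _ = A := by field_simp

/-- **The four-arm exponent from (16)ℕ, (9)ℕ, alternating separation and the bridge**
(Smirnov–Werner 2001, Thm. 4 for `j = 4`, with the discrete inputs stated per colour pattern): IF
`π₄(ρ r, ρ R) → L(r, R)` for all integers `1 ≤ r < R` (SW (16): Smirnov's theorem / the full scaling
limit), `log L(1, n) / log n → -5/4` (SW (9) with (15): the `SLE₆` exponent), the well-separated
alternating event is comparable to the alternating event at `p = 1/2` (Nolin Thm. 11, `σ = BWBW`),
and the order-free event is dominated by the alternating one (Nolin Prop. 20), THEN
`fourArm_exponent`. [cite: SmirnovWernerMRL2001, Thm. 4 (j = 4), §4 (9), (10), (16)] [cite: Nolin2008, Thm. 11 and Prop. 20 (arXiv 0711.4948: Thm. 10, Prop. 19)] -/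
theorem fourArm_exponent_of_altSeparation (L : ℕ → ℕ → ℝ)
    (hlim : ∀ r R : ℕ, 1 ≤ r → r < R →
      Tendsto (fun ρ : ℕ => critFourArmProb (ρ * r) (ρ * R)) atTop (𝓝 (L r R)))
    (hexp : Tendsto (fun n : ℕ => Real.log (L 1 n) / Real.log n) atTop (𝓝 (-(5 / 4))))
    (hAlt : ∃ c : ℝ, 0 < c ∧ ∃ n₀ : ℕ, ∀ n N : ℕ, n₀ ≤ n → 2 * n ≤ N →
      c * (triSitePercolation half).real (altFourArm n N) ≤
        (triSitePercolation half).real (sepFourArm n N))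
    (hBr : ∃ c : ℝ, 0 < c ∧ ∃ n₀ : ℕ, ∀ n N : ℕ, n₀ ≤ n → 2 * n ≤ N →
      c * critFourArmProb n N ≤ (triSitePercolation half).real (altFourArm n N)) :
    fourArm_exponent :=
  fourArm_exponent_of_separation L hlim hexp (critFourArm_separation_of_alt hAlt hBr)

/-- **The four-arm exponent from (16)ℕ, (9)ℕ, alternating separation, adjacent landing and the
flip** — the same with the bridge split into its two printed halves
(`fourArm_bridge_of_landing_of_flip`). What remains for `fourArm_exponent_holds` after this file:
the two continuum inputs, Nolin's arm-separation Thm. 11 for `j = 4` in the two arrangements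
`BWBW` (to `sepFourArm`) and `BBWW` (to `landedFourAdj`), and the colour-exchange flip of Prop. 20.
[cite: SmirnovWernerMRL2001, Thm. 4 (j = 4), §4 (9), (10), (16)] [cite: Nolin2008, Thm. 11 and §5.1 Prop. 20 (arXiv 0711.4948: Thm. 10, Prop. 19)] -/
theorem fourArm_exponent_of_altSeparation_of_flip (L : ℕ → ℕ → ℝ)
    (hlim : ∀ r R : ℕ, 1 ≤ r → r < R →
      Tendsto (fun ρ : ℕ => critFourArmProb (ρ * r) (ρ * R)) atTop (𝓝 (L r R)))
    (hexp : Tendsto (fun n : ℕ => Real.log (L 1 n) / Real.log n) atTop (𝓝 (-(5 / 4))))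
    (hAlt : ∃ c : ℝ, 0 < c ∧ ∃ n₀ : ℕ, ∀ n N : ℕ, n₀ ≤ n → 2 * n ≤ N →
      c * (triSitePercolation half).real (altFourArm n N) ≤
        (triSitePercolation half).real (sepFourArm n N))
    (hLand : ∃ c : ℝ, 0 < c ∧ ∃ n₀ : ℕ, ∀ n N : ℕ, n₀ ≤ n → 2 * n ≤ N →
      c * (triSitePercolation half).real (adjFourArm n N) ≤
        (triSitePercolation half).real (landedFourAdj n N))
    (hFlip : ∃ C : ℝ, 0 < C ∧ ∃ n₀ : ℕ, ∀ n N : ℕ, n₀ ≤ n → 2 * n ≤ N →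
      (triSitePercolation half).real (landedFourAdj n N) ≤
        C * (triSitePercolation half).real (altFourArm n N)) :
    fourArm_exponent :=
  fourArm_exponent_of_altSeparation L hlim hexp hAlt (fourArm_bridge_of_landing_of_flip hLand hFlip)

/-- **The critical slice of near-critical ALTERNATING separation.** At `t = 1/2` the restriction
`N ≤ L(t, ε)` is void and `π̂^alt_{1/2}(n, N) = P_{1/2}(altFourArm n N)` (`altFourArmProbAt_half`),
so the near-critical alternating separation hypothesis of the `θ`-exponent programme
(`PivotalLowerBoundAlt.lean`: `c · π̂^alt_t(n, N) ≤ P_t(sepFourArm n N)` uniformly for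
`t ∈ [1/2, 1/2 + δ)`, `N ≤ L(t, ε)`; Nolin 2008, Thm. 11, stated uniformly in `p̂ ∈ [P_p, P_{1-p}]`,
`N ≤ L(p)` [arXiv Thm. 10]) contains the critical one used here — one separation theorem serves
both programmes. [cite: Nolin2008, Thm. 11 (arXiv 0711.4948: Thm. 10)] -/
theorem critAltFourArm_separation_of_nearCritical
    (hsep : ∃ ε₁ > (0 : ℝ), ∀ ⦃ε : ℝ⦄, 0 < ε → ε < ε₁ →
      ∃ n₀ : ℕ, ∃ δ > (0 : ℝ), ∃ c > (0 : ℝ),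
        ∀ t : unitInterval, 1 / 2 ≤ (t : ℝ) → (t : ℝ) < 1 / 2 + δ →
          ∀ n N : ℕ, n₀ ≤ n → 2 * n ≤ N → (1 / 2 < (t : ℝ) → N ≤ charLengthW ε t) →
            c * altFourArmProbAt t n N ≤ (triSitePercolation t).real (sepFourArm n N)) :
    ∃ c : ℝ, 0 < c ∧ ∃ n₀ : ℕ, ∀ n N : ℕ, n₀ ≤ n → 2 * n ≤ N →
      c * (triSitePercolation half).real (altFourArm n N) ≤
        (triSitePercolation half).real (sepFourArm n N) := by
  obtain ⟨ε₁, hε₁, h⟩ := hsep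
  obtain ⟨n₀, δ, hδ, c, hc, hq⟩ := h (half_pos hε₁) (half_lt_self hε₁)
  refine ⟨c, hc, n₀, fun n N hn hnN => ?_⟩
  have key := hq half (by simp) (by simp; linarith) n N hn hnN (fun hlt => absurd hlt (by simp))
  simpa only [altFourArmProbAt_half] using key

/-- **The four-arm exponent from its two continuum inputs, near-critical alternating separation and
the bridge**: `fourArm_exponent_of_altSeparation` with `critAltFourArm_separation_of_nearCritical`.
[cite: SmirnovWernerMRL2001, Thm. 4 (j = 4), §4 (9), (10), (16)] [cite: Nolin2008, Thm. 11 and Prop. 20 (arXiv 0711.4948: Thm. 10, Prop. 19)] -/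
theorem fourArm_exponent_of_scalingLimit_of_nearCritical_altSeparation (L : ℕ → ℕ → ℝ)
    (hlim : ∀ r R : ℕ, 1 ≤ r → r < R →
      Tendsto (fun ρ : ℕ => critFourArmProb (ρ * r) (ρ * R)) atTop (𝓝 (L r R)))
    (hexp : Tendsto (fun n : ℕ => Real.log (L 1 n) / Real.log n) atTop (𝓝 (-(5 / 4))))
    (hsep : ∃ ε₁ > (0 : ℝ), ∀ ⦃ε : ℝ⦄, 0 < ε → ε < ε₁ →
      ∃ n₀ : ℕ, ∃ δ > (0 : ℝ), ∃ c > (0 : ℝ),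
        ∀ t : unitInterval, 1 / 2 ≤ (t : ℝ) → (t : ℝ) < 1 / 2 + δ →
          ∀ n N : ℕ, n₀ ≤ n → 2 * n ≤ N → (1 / 2 < (t : ℝ) → N ≤ charLengthW ε t) →
            c * altFourArmProbAt t n N ≤ (triSitePercolation t).real (sepFourArm n N))
    (hBr : ∃ c : ℝ, 0 < c ∧ ∃ n₀ : ℕ, ∀ n N : ℕ, n₀ ≤ n → 2 * n ≤ N →
      c * critFourArmProb n N ≤ (triSitePercolation half).real (altFourArm n N)) :
    fourArm_exponent :=
  fourArm_exponent_of_altSeparation L hlim hexp (critAltFourArm_separation_of_nearCritical hsep) hBr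

end Literature.Probability.Percolation

end
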